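import Mathlib

/-!
# Crux `ShallowShadows.ShadowFormulaTransfer` (stmt-ValiantsHypothesis-17124), line
# `Sketch-ideator1` — the registered stub `stub_shadowOfSos` (SOS certificates are phantom-free)

The SHADOW of a polynomial `q` is the monotone Boolean function
`B q : a ↦ [∃ m ∈ supp q, supp m ⊆ {l | a l}]` (the lattice reading of S. Jukna, arXiv:1406.3065,
Lemma 7, and of CFM, arXiv:2512.19515, Observation 1.3). Line `Sketch-ideator1` reduces the crux
to POSITIVITY CERTIFICATES; kind (S) is an identity `p(x²) = Σ_{i<T} c_i (Π_{j<k} G_ij(x))²` with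
`c_i > 0` and SIGNED real polynomials `G_ij`. This file proves that such a certificate reads off
the shadow exactly, `B p = ∨_i ∧_j B (G_ij)` (`stub_shadowOfSos`): in spite of the signs, no
phantom monomial survives and no monomial of `p` is lost.

Proof. Fix `a : ι → Bool` and the "restriction to the face `a`" algebra hom
`ρ_a := bind₁ (l ↦ if a l then X l else 0)`, which fixes every monomial supported inside
`{l | a l}` and kills every other one (`restrictFace_monomial`, `coeff_restrictFace`), so
`B q a ↔ ρ_a q ≠ 0` (`shadow_iff_restrictFace_ne_zero`). Squaring the variables does not change
the shadow (`shadow_expand_two_iff`, via `MvPolynomial.support_expand`). Applying `ρ_a` to the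
certificate, `ρ_a (p(x²)) = Σ_i c_i (Π_j ρ_a G_ij)²` is a sum of polynomials that are pointwise
nonnegative on `ℝ^ι`; such a sum vanishes iff every summand vanishes, because a polynomial over
the infinite domain `ℝ` that vanishes pointwise is zero (`MvPolynomial.funext`;
`sum_ne_zero_iff_of_eval_nonneg`). Finally `c_i (Π_j ρ_a G_ij)² ≠ 0 ↔ ∀ j, ρ_a G_ij ≠ 0` because
`MvPolynomial ι ℝ` is a domain. The positivity trick is folklore real algebra.

Main result: `stub_shadowOfSos`.

References: S. Jukna, *Lower bounds for monotone counting circuits*, arXiv:1406.3065, Lemma 7;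
CFM, arXiv:2512.19515, Observation 1.3.
-/

-- Sub = Summit single-conjunct layout: the duplicated namespace component is mandated by the tree.
set_option linter.dupNamespace false

noncomputable section

namespace Summit.ValiantsHypothesis.ValiantsHypothesis.Theorems.ShallowShadowsShadowFormulaTransfer

open MvPolynomial

/-! ### Restriction to a face of the Boolean cube -/

/-- The face restriction `ρ_a = bind₁ (l ↦ if a l then X l else 0)` fixes a monomial supported
inside `{l | a l}` and kills every other monomial. [folklore] -/
theorem restrictFace_monomial {ι R : Type*} [CommSemiring R] (a : ι → Bool) (d : ι →₀ ℕ)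
    (r : R) :
    bind₁ (fun l => if a l then (X l : MvPolynomial ι R) else 0) (monomial d r) =
      if ∀ l ∈ d.support, a l = true then monomial d r else 0 := by
  classical
  rw [bind₁_monomial]
  split_ifs with h
  · rw [Finset.prod_congr rfl fun l hl => by rw [if_pos (h l hl)], prod_X_pow_eq_monomial,
      C_mul_monomial, mul_one]
  · push Not at h
    obtain ⟨l, hl, hal⟩ := h
    rw [Finset.prod_eq_zero hl, mul_zero]
    rw [if_neg (by simpa using hal), zero_pow (Finsupp.mem_support_iff.mp hl)]

/-- Coefficients of the face restriction: `coeff m (ρ_a q)` is `coeff m q` if `supp m ⊆ {l | a l}`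
and `0` otherwise. [folklore] -/
theorem coeff_restrictFace {ι R : Type*} [CommSemiring R] (a : ι → Bool) (m : ι →₀ ℕ)
    (q : MvPolynomial ι R) :
    coeff m (bind₁ (fun l => if a l then (X l : MvPolynomial ι R) else 0) q) =
      if ∀ l ∈ m.support, a l = true then coeff m q else 0 := by
  classical
  induction q using MvPolynomial.induction_on' with
  | monomial d r =>
    rw [restrictFace_monomial]
    by_cases hdm : d = m
    · subst hdm
      by_cases hP : ∀ l ∈ d.support, a l = true
      · rw [if_pos hP, if_pos hP]
      · rw [if_neg hP, if_neg hP, coeff_zero]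
    · have h0 : coeff m (monomial d r) = 0 := by rw [coeff_monomial, if_neg hdm]
      by_cases hP : ∀ l ∈ d.support, a l = true
      · rw [if_pos hP, h0, ite_self]
      · rw [if_neg hP, h0, ite_self, coeff_zero]
  | add p q hp hq =>
    rw [map_add, coeff_add, coeff_add, hp, hq]
    by_cases hP : ∀ l ∈ m.support, a l = true
    · rw [if_pos hP, if_pos hP, if_pos hP]
    · rw [if_neg hP, if_neg hP, if_neg hP, add_zero]

/-- **The shadow is nonvanishing of the face restriction**: `B q a ↔ ρ_a q ≠ 0`. [folklore] -/
theorem shadow_iff_restrictFace_ne_zero {ι R : Type*} [CommSemiring R] (q : MvPolynomial ι R)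
    (a : ι → Bool) :
    (∃ m ∈ q.support, ∀ l ∈ m.support, a l = true) ↔
      bind₁ (fun l => if a l then (X l : MvPolynomial ι R) else 0) q ≠ 0 := by
  rw [ne_zero_iff]
  simp only [coeff_restrictFace, mem_support_iff]
  constructor
  · rintro ⟨m, hm, ha⟩
    exact ⟨m, by rwa [if_pos ha]⟩
  · rintro ⟨m, hm⟩
    by_cases ha : ∀ l ∈ m.support, a l = true
    · rw [if_pos ha] at hm
      exact ⟨m, hm, ha⟩
    · exact absurd (if_neg ha) hm

/-- Squaring the variables does not change the shadow: `B (q(x²)) = B q`. [folklore] -/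
theorem shadow_expand_two_iff {ι R : Type*} [CommSemiring R] (q : MvPolynomial ι R)
    (a : ι → Bool) :
    (∃ m ∈ (expand 2 q).support, ∀ l ∈ m.support, a l = true) ↔
      ∃ m ∈ q.support, ∀ l ∈ m.support, a l = true := by
  classical
  rw [support_expand q two_ne_zero, Finset.exists_mem_image]
  simp only [Finsupp.support_smul_eq two_ne_zero]

/-! ### Positivity: a sum of pointwise nonnegative real polynomials -/

/-- A finite sum of real polynomials that are pointwise nonnegative on `ℝ^ι` is nonzero iff some
summand is nonzero: a polynomial over the infinite domain `ℝ` vanishing at every point is zero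
(`MvPolynomial.funext`). [folklore] -/
theorem sum_ne_zero_iff_of_eval_nonneg {ι α : Type*} (s : Finset α) (F : α → MvPolynomial ι ℝ)
    (hF : ∀ i ∈ s, ∀ x : ι → ℝ, 0 ≤ eval x (F i)) :
    ∑ i ∈ s, F i ≠ 0 ↔ ∃ i ∈ s, F i ≠ 0 := by
  refine ⟨Finset.exists_ne_zero_of_sum_ne_zero, ?_⟩
  rintro ⟨i, hi, hFi⟩ hsum
  refine hFi (MvPolynomial.funext fun x => ?_)
  have hx : ∑ j ∈ s, eval x (F j) = 0 := by rw [← map_sum, hsum, map_zero]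
  rw [Finset.sum_eq_zero_iff_of_nonneg fun j hj => hF j hj x] at hx
  rw [map_zero]
  exact hx i hi

/-! ### The stub -/

/-- **SOS certificates are phantom-free** (registered stub `stub_shadowOfSos` of line
`Sketch-ideator1`). If `p(x²) = Σ_{i<T} c_i (Π_{j<k} G_ij)²` with all `c_i > 0` and arbitrary
signed real polynomials `G_ij`, then the shadow of `p` is read off the certificate:
`B p a ↔ ∃ i, ∀ j, B (G_ij) a` for every `a : ι → Bool`. [folklore] -/
theorem stub_shadowOfSos : ∀ (ι : Type) (T k : ℕ) (c : Fin T → ℝ)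
    (G : Fin T → Fin k → MvPolynomial ι ℝ) (p : MvPolynomial ι ℝ), (∀ i, 0 < c i) →
    MvPolynomial.expand 2 p = ∑ i, MvPolynomial.C (c i) * (∏ j, G i j) ^ 2 →
    ∀ a : ι → Bool, (∃ m ∈ p.support, ∀ i ∈ m.support, a i = true) ↔
      ∃ i : Fin T, ∀ j : Fin k, ∃ m ∈ (G i j).support, ∀ l ∈ m.support, a l = true := by
  intro ι T k c G p hc hp a
  rw [← shadow_expand_two_iff p a, shadow_iff_restrictFace_ne_zero, hp]
  simp only [map_sum, map_mul, map_pow, map_prod, bind₁_C_right]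
  rw [sum_ne_zero_iff_of_eval_nonneg Finset.univ _ fun i _ x => by
    rw [map_mul, eval_C, map_pow]
    exact mul_nonneg (hc i).le (sq_nonneg _)]
  simp only [Finset.mem_univ, true_and, ne_eq, mul_eq_zero, C_eq_zero, (hc _).ne', false_or,
    pow_eq_zero_iff two_ne_zero, Finset.prod_eq_zero_iff, not_exists,
    shadow_iff_restrictFace_ne_zero]

end Summit.ValiantsHypothesis.ValiantsHypothesis.Theorems.ShallowShadowsShadowFormulaTransfer
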